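import Literature.ModelTheory.ExponentialFields.RealExpTransfer
import Mathlib.Analysis.SpecialFunctions.Complex.LogBounds
import HarnessLib

/-!
# Strict inequalities between closed exponential terms transfer from `ℝ` to every ordered exponential field with `E(x) ≥ 1 + x`

Family `periods` (periods.S27), topic `Literature/ModelTheory/ExponentialFields`: a leaf of the
decomposition of the conditional half of Macintyre–Wilkie's theorem
(`Literature.ModelTheory.ExponentialFields.macintyreWilkie_existential_of_schanuelProperty`,
`MacintyreWilkie.lean`; reduced in `MacintyreWilkieREAxioms.lean` to: under Schanuel, an r.e. set
of true sentences proves every true existential sentence of `ℝ_exp`).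

In Macintyre–Wilkie's argument (transposed verbatim by Jones–Servi 2011, §3), truth of a
numerical inequality at a *rational point* has to be available in *every model* of the weak
recursive theory `T`: Jones–Servi 2011, **Lemma 3.6**: "Let `h ∈ M_n(ℤ[α])`, `q̄ ∈ ℚⁿ` and
suppose that `ℝ^α ⊨ h(q̄) < 0`. Then `T ⊢ h(q̄) < 0`", proved there by Taylor expansion: "we can
find, for every `n ∈ ℕ`, semi-algebraic functions `f_n, g_n` such that
`T ⊨ f_n(q̄) < h(q̄) < g_n(q̄) ∧ |f_n(q̄) − g_n(q̄)| < 1/n`", after which "the truth of the last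
statement can be transferred to every model of `T`".  This file **proves** the corresponding
statement for the exponential function and *closed terms* of `Language.orderedExpRing` (terms
without variables: built from `0, 1` by `+, *, -, exp`; the values `h(q̄)` at rational points are
among them up to clearing denominators), for the weakest natural `T`: the structures considered
are ordered fields `K` carrying a map `E` with

  `E(x + y) = E(x) · E(y)` and `x + 1 ≤ E(x)` (`Literature.ModelTheory.ExponentialFields.IsOrderedExp`),

two sentences true in `ℝ_exp` (`Real.exp_add`, `Real.add_one_le_exp`).  From them alone:
`E(0) = 1`, `E > 0`, `E` is strictly increasing, and the two-sided *rational enclosures*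
`(1 + x/m)^m ≤ E(x) ≤ (1 − x/m)^{−m}` (`IsOrderedExp.one_add_div_pow_le`,
`IsOrderedExp.le_inv_one_sub_div_pow`), which in `ℝ` converge to `eˣ`
(`Real.tendsto_one_add_div_pow_exp`).  Hence (`exists_uniform_enclosure`) every closed term `t`
admits, for every rational `r > 0`, a rational centre `c` with `|t^K − c| < r` **simultaneously in
all** such `K` (including `ℝ` itself), and therefore (`realize_lt_realize_of_real`): if
`s^ℝ < t^ℝ` then `s^K < t^K` in every such `K`.  Equalities and non-strict inequalities do *not*
transfer (an accidental equality of exponential constants in `ℝ` need not hold in `K`), and none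
is claimed.

## Main statements (all proved)

* `IsOrderedExp E`: the two axioms; `IsOrderedExp.real : IsOrderedExp Real.exp`; consequences
  `map_zero`, `pos`, `strictMono`, `one_add_div_pow_le`, `le_inv_one_sub_div_pow`.
* `exists_uniform_enclosure`: uniform rational enclosures of closed terms.
* `realize_lt_realize_of_real`: transfer of strict inequalities between closed terms from `ℝ` to
  every lawful `Language.orderedExpRing`-structure on an ordered field whose `exp` symbol is
  interpreted by an `IsOrderedExp` map (`RealExpModel.LawfulStructure`, `RealExpTransfer.lean`).
* `realize_expFormulaLt_of_real`: the same for the atomic formula `s < t` (`ExpFormula.lt`).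

## Design

Structures are in `Type` (universe `0`), like the bundled models
`Theory.ModelType.{0,0,0}` used throughout this directory, so that `ℝ` is one of the `K`.
Closed terms are `Language.orderedExpRing.Term α` for an empty index type `α` (`[IsEmpty α]`),
covering both `Empty` and `Empty ⊕ Fin 0`.

## References

* G. O. Jones, T. Servi, *On the decidability of the real field with a generic power function*,
  J. Symb. Log. 76 (2011), Lemma 3.6.
* A. Macintyre, A. J. Wilkie, *On the decidability of the real exponential field*, in:
  Kreiseliana, A K Peters (1996), 441–467, §4.
* L. van den Dries, *Exponential rings, exponential polynomials and exponential functions*,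
  Pacific J. Math. 113 (1984), §1 (exponential rings; the axiom `E(x) ≥ 1 + x` is the one of
  Dahn–Wolter's ordered exponential fields).
-/

noncomputable section

open FirstOrder FirstOrder.Language Filter
open scoped Topology

namespace Literature.ModelTheory.ExponentialFields

/-! ### Ordered exponential maps with `E(x) ≥ 1 + x` -/

section OrderedExp

variable {K : Type*} [Field K] [LinearOrder K] [IsStrictOrderedRing K]

/-- An **ordered exponential in the weak sense** on an ordered field `K`: a map `E : K → K` with
`E(x + y) = E(x)E(y)` and `x + 1 ≤ E(x)` — the two properties of `Real.exp` (`Real.exp_add`,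
`Real.add_one_le_exp`) from which rational enclosures of the values of `E` follow.  (An
*exponential* in the sense of S. Kuhlmann / Krapp 2019, §2 — an order isomorphism
`(K, +, <) → (K_{>0}, ·, <)` — satisfying the first-order consequence `∀x, exp x ≥ 1 + x` of
`Th(ℝ_exp)` is one; every model of any true theory containing these two sentences carries one.)
A definition introduced for the decomposition of Macintyre–Wilkie's theorem. [folklore] -/
structure IsOrderedExp (E : K → K) : Prop where
  /-- `E` is a homomorphism from `(K, +)` to `(K, ·)`. -/
  map_add : ∀ x y : K, E (x + y) = E x * E y
  /-- The growth axiom `x + 1 ≤ E(x)`. -/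
  add_one_le : ∀ x : K, x + 1 ≤ E x

/-- `Real.exp` is an ordered exponential in this sense. [folklore] -/
theorem IsOrderedExp.real : IsOrderedExp Real.exp :=
  ⟨Real.exp_add, Real.add_one_le_exp⟩

namespace IsOrderedExp

variable {E : K → K} (hE : IsOrderedExp E)
include hE

/-- `E(0) = 1` (from `E(0) = E(0)²` and `E(0) ≥ 1`). [folklore] -/
theorem map_zero : E 0 = 1 := by
  have h1 : (1 : K) ≤ E 0 := by simpa using hE.add_one_le 0
  have h2 : E 0 = E 0 * E 0 := by simpa using hE.map_add 0 0
  have hpos : 0 < E 0 := lt_of_lt_of_le one_pos h1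
  have : E 0 * 1 = E 0 * E 0 := by simpa using h2
  exact (mul_left_cancel₀ hpos.ne' this).symm

/-- `E(x) · E(−x) = 1`. [folklore] -/
theorem mul_map_neg (x : K) : E x * E (-x) = 1 := by
  rw [← hE.map_add, add_neg_cancel, hE.map_zero]

/-- `E(x) > 0` (as `E(x) = E(x/2)²` is a nonzero square). [folklore] -/
theorem pos (x : K) : 0 < E x := by
  have hsq : E x = E (x / 2) * E (x / 2) := by rw [← hE.map_add, add_halves]
  have hne : E x ≠ 0 := fun h => by simpa [h] using hE.mul_map_neg x
  rw [hsq] at hne ⊢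
  exact lt_of_le_of_ne (mul_self_nonneg _) (Ne.symm hne)

/-- `E(−x) = E(x)⁻¹`. [folklore] -/
theorem map_neg (x : K) : E (-x) = (E x)⁻¹ :=
  eq_inv_of_mul_eq_one_right (hE.mul_map_neg x)

/-- `E` is strictly increasing: for `x < y`, `E(y) = E(x)E(y − x) ≥ E(x)(1 + (y − x)) > E(x)`. [folklore] -/
theorem strictMono : StrictMono E := by
  intro x y hxy
  have h : E y = E x * E (y - x) := by rw [← hE.map_add, add_sub_cancel]
  have h1 : (1 : K) < E (y - x) := lt_of_lt_of_le (by linarith) (hE.add_one_le (y - x))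
  rw [h]
  exact lt_mul_of_one_lt_right (hE.pos x) h1

/-- `E(n • x) = E(x)ⁿ`. [folklore] -/
theorem map_nsmul (n : ℕ) (x : K) : E (n • x) = E x ^ n := by
  induction n with
  | zero => simp [hE.map_zero]
  | succ n ih => rw [succ_nsmul, hE.map_add, ih, pow_succ]

/-- `E(x) = E(x/m)ᵐ` for `m ≥ 1`. [folklore] -/
theorem eq_pow_map_div {m : ℕ} (hm : 0 < m) (x : K) : E x = E (x / m) ^ m := by
  rw [← hE.map_nsmul, nsmul_eq_mul, mul_div_cancel₀]
  exact_mod_cast hm.ne'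

/-- **Lower rational enclosure**: `(1 + x/m)ᵐ ≤ E(x)` whenever `0 ≤ 1 + x/m` (`m ≥ 1`). [folklore] -/
theorem one_add_div_pow_le {m : ℕ} (hm : 0 < m) {x : K} (hx : 0 ≤ 1 + x / m) :
    (1 + x / m) ^ m ≤ E x := by
  rw [hE.eq_pow_map_div hm x]
  exact pow_le_pow_left₀ hx (by simpa [add_comm] using hE.add_one_le (x / m)) m

/-- **Upper rational enclosure**: `E(x) ≤ ((1 − x/m)ᵐ)⁻¹` whenever `0 < 1 − x/m` (`m ≥ 1`),
from `E(−x/m) ≥ 1 − x/m > 0`. [folklore] -/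
theorem le_inv_one_sub_div_pow {m : ℕ} (hm : 0 < m) {x : K} (hx : 0 < 1 - x / m) :
    E x ≤ ((1 - x / m) ^ m)⁻¹ := by
  rw [hE.eq_pow_map_div hm x, ← inv_pow]
  refine pow_le_pow_left₀ (hE.pos _).le ?_ m
  have h1 : 1 - x / m ≤ E (-(x / m)) := by
    simpa [sub_eq_add_neg, add_comm] using hE.add_one_le (-(x / m))
  rw [hE.map_neg] at h1
  simpa using inv_anti₀ hx h1

end IsOrderedExp

end OrderedExp

/-! ### The rational enclosing sequences and their limits in `ℝ` -/

/-- The lower enclosure `ℓₘ(q) = (1 + q/m)ᵐ ∈ ℚ`. [folklore] -/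
def lowerEncl (q : ℚ) (m : ℕ) : ℚ := (1 + q / m) ^ m

/-- The upper enclosure `uₘ(q) = ((1 − q/m)ᵐ)⁻¹ ∈ ℚ`. [folklore] -/
def upperEncl (q : ℚ) (m : ℕ) : ℚ := ((1 - q / m) ^ m)⁻¹

/-- `ℓₘ(q) → e^q`. [folklore] -/
theorem tendsto_lowerEncl (q : ℚ) :
    Tendsto (fun m => (lowerEncl q m : ℝ)) atTop (𝓝 (Real.exp q)) := by
  have h := Real.tendsto_one_add_div_pow_exp (q : ℝ)
  refine h.congr fun m => ?_
  simp [lowerEncl]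

/-- `uₘ(q) → e^q` (as `(1 − q/m)ᵐ → e^{−q}`). [folklore] -/
theorem tendsto_upperEncl (q : ℚ) :
    Tendsto (fun m => (upperEncl q m : ℝ)) atTop (𝓝 (Real.exp q)) := by
  have h := (Real.tendsto_one_add_div_pow_exp (-(q : ℝ))).inv₀ (Real.exp_pos _).ne'
  rw [Real.exp_neg, inv_inv] at h
  refine h.congr fun m => ?_
  simp [upperEncl, sub_eq_add_neg, neg_div]

section Enclosures

variable {K : Type*} [Field K] [LinearOrder K] [IsStrictOrderedRing K] {E : K → K}

/-- In every ordered field with an `IsOrderedExp` map: `ℓₘ(q) ≤ E(q)` for `m ≥ |q|`, `m ≥ 1`. [folklore] -/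
theorem lowerEncl_le (hE : IsOrderedExp E) (q : ℚ) {m : ℕ} (hm : 0 < m) (hqm : -q ≤ m) :
    ((lowerEncl q m : ℚ) : K) ≤ E q := by
  have hx : (0 : K) ≤ 1 + (q : K) / m := by
    have hmK : (0 : K) < m := by exact_mod_cast hm
    have h' : (-1 : K) ≤ (q : K) / m := by
      rw [le_div_iff₀ hmK]
      have : ((-q : ℚ) : K) ≤ ((m : ℚ) : K) := Rat.cast_le.2 (by exact_mod_cast hqm)
      push_cast at this
      linarith
    linarith
  have := hE.one_add_div_pow_le hm hx
  simpa [lowerEncl] using this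

/-- In every ordered field with an `IsOrderedExp` map: `E(q) ≤ uₘ(q)` for `m > q`, `m ≥ 1`. [folklore] -/
theorem le_upperEncl (hE : IsOrderedExp E) (q : ℚ) {m : ℕ} (hm : 0 < m) (hqm : q < m) :
    E q ≤ ((upperEncl q m : ℚ) : K) := by
  have hx : (0 : K) < 1 - (q : K) / m := by
    have hmK : (0 : K) < m := by exact_mod_cast hm
    have h' : (q : K) / m < 1 := by
      rw [div_lt_iff₀ hmK]
      have : ((q : ℚ) : K) < ((m : ℚ) : K) := Rat.cast_lt.2 (by exact_mod_cast hqm)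
      push_cast at this
      linarith
    linarith
  have := hE.le_inv_one_sub_div_pow hm hx
  simpa [upperEncl] using this

end Enclosures

/-! ### Uniform rational enclosures of closed terms -/

section Terms

variable {α : Type} [IsEmpty α]

/-- `UniformlyNear t c r`: in **every** ordered field `K` (in `Type`) carrying a lawful
`Language.orderedExpRing`-structure whose `exp` symbol is interpreted by an `IsOrderedExp` map,
the closed term `t` realizes within `r` of the rational `c`: `|t^K − c| < r`. [folklore] -/
def UniformlyNear (t : Language.orderedExpRing.Term α) (c r : ℚ) : Prop :=
  ∀ (K : Type) [Field K] [LinearOrder K] [IsStrictOrderedRing K]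
    [Language.orderedExpRing.Structure K] [RealExpModel.LawfulStructure K] (E : K → K),
    IsOrderedExp E →
    (∀ v : Fin 1 → K, Structure.funMap (L := Language.orderedExpRing) expRingFunc.exp v = E (v 0)) →
    ∀ v : α → K, |t.realize v - (c : K)| < (r : K)

omit [IsEmpty α] in
/-- `ℝ_exp` is one of the structures quantified over in `UniformlyNear`. [folklore] -/
theorem UniformlyNear.real {t : Language.orderedExpRing.Term α} {c r : ℚ} (h : UniformlyNear t c r)
    (v : α → ℝ) : |t.realize v - (c : ℝ)| < (r : ℝ) :=
  h ℝ Real.exp IsOrderedExp.real (fun _ => rfl) v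

omit [IsEmpty α] in
/-- Shrinking the radius is allowed. [folklore] -/
theorem UniformlyNear.mono {t : Language.orderedExpRing.Term α} {c r r' : ℚ} (h : UniformlyNear t c r)
    (hr : r ≤ r') : UniformlyNear t c r' :=
  fun K _ _ _ _ _ E hE hexp v => lt_of_lt_of_le (h K E hE hexp v) (Rat.cast_le.2 hr)

/-- **Uniform rational enclosures of closed terms.** For every closed term `t` of
`Language.orderedExpRing` and every rational `r > 0` there is a rational `c` with `|t^K − c| < r`
in every ordered field `K` with a lawful structure whose `exp` is an `IsOrderedExp` map
(by induction on `t`: `+`, `-` add the radii; `*` uses a preliminary bound of radius `1`; `exp`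
uses the strict monotonicity of `E`, the enclosures `ℓₘ ≤ E ≤ uₘ` valid in every `K`, and their
convergence in `ℝ` to choose `m`).  This is the uniform form of the semi-algebraic bounds
`f_n(q̄) < h(q̄) < g_n(q̄)`, `|f_n − g_n| < 1/n` of Jones–Servi 2011, proof of Lemma 3.6. [cite: JonesServi2011, Lemma 3.6 (proof)] -/
theorem exists_uniformlyNear (t : Language.orderedExpRing.Term α) {r : ℚ} (hr : 0 < r) :
    ∃ c : ℚ, UniformlyNear t c r := by
  induction t generalizing r with
  | var a => exact isEmptyElim a
  | func f ts ih =>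
    cases f with
    | zero =>
      refine ⟨0, fun K _ _ _ _ _ E hE hexp v => ?_⟩
      rw [Term.realize_func, RealExpModel.LawfulStructure.funMap_zero]
      simpa using hr
    | one =>
      refine ⟨1, fun K _ _ _ _ _ E hE hexp v => ?_⟩
      rw [Term.realize_func, RealExpModel.LawfulStructure.funMap_one]
      simpa using hr
    | neg =>
      obtain ⟨c, hc⟩ := ih 0 hr
      refine ⟨-c, fun K _ _ _ _ _ E hE hexp v => ?_⟩
      rw [Term.realize_func, RealExpModel.LawfulStructure.funMap_neg]
      have := hc K E hE hexp v
      rw [← abs_neg] at this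
      push_cast
      convert this using 2
      ring
    | add =>
      obtain ⟨c₀, hc₀⟩ := ih 0 (half_pos hr)
      obtain ⟨c₁, hc₁⟩ := ih 1 (half_pos hr)
      refine ⟨c₀ + c₁, fun K _ _ _ _ _ E hE hexp v => ?_⟩
      rw [Term.realize_func, RealExpModel.LawfulStructure.funMap_add]
      have h₀ := hc₀ K E hE hexp v
      have h₁ := hc₁ K E hE hexp v
      push_cast at h₀ h₁ ⊢
      calc |(ts 0).realize v + (ts 1).realize v - (c₀ + c₁)|
          = |((ts 0).realize v - c₀) + ((ts 1).realize v - c₁)| := by ring_nf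
        _ ≤ |(ts 0).realize v - c₀| + |(ts 1).realize v - c₁| := abs_add_le _ _
        _ < r / 2 + r / 2 := add_lt_add h₀ h₁
        _ = r := by ring
    | mul =>
      -- a preliminary bound `|s| < B₀` on the first factor
      obtain ⟨d₀, hd₀⟩ := ih 0 one_pos
      set B₀ : ℚ := |d₀| + 1 with hB₀
      have hB₀pos : 0 < B₀ := by positivity
      obtain ⟨c₁, hc₁⟩ := ih 1 (div_pos hr (mul_pos two_pos hB₀pos))
      have hC : 0 < |c₁| + 1 := by positivity
      obtain ⟨c₀, hc₀⟩ := ih 0 (div_pos hr (mul_pos two_pos hC))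
      refine ⟨c₀ * c₁, fun K _ _ _ _ _ E hE hexp v => ?_⟩
      rw [Term.realize_func, RealExpModel.LawfulStructure.funMap_mul]
      have hs₀ := hd₀ K E hE hexp v
      have hs := hc₀ K E hE hexp v
      have ht := hc₁ K E hE hexp v
      push_cast at hs₀ hs ht ⊢
      set s : K := (ts 0).realize v
      set t : K := (ts 1).realize v
      have hsB : |s| < (B₀ : K) := by
        have : |s| ≤ |s - d₀| + |(d₀ : K)| := by
          simpa using abs_add_le (s - d₀) (d₀ : K)
        push_cast [hB₀]
        linarith
      have hB₀K : (0 : K) < B₀ := by exact_mod_cast hB₀pos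
      have hCK : (0 : K) < |(c₁ : K)| + 1 := by positivity
      calc |s * t - c₀ * c₁| = |s * (t - c₁) + c₁ * (s - c₀)| := by ring_nf
        _ ≤ |s * (t - c₁)| + |c₁ * (s - c₀)| := abs_add_le _ _
        _ = |s| * |t - c₁| + |(c₁ : K)| * |s - c₀| := by rw [abs_mul, abs_mul]
        _ < (B₀ : K) * ((r : K) / (2 * (B₀ : K))) +
              (|(c₁ : K)| + 1) * ((r : K) / (2 * (|(c₁ : K)| + 1))) := by
            apply add_lt_add
            · exact mul_lt_mul'' hsB ht (abs_nonneg _) (abs_nonneg _)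
            · exact mul_lt_mul' (by linarith) hs (abs_nonneg _) hCK
        _ = r := by
            field_simp
            ring
    | exp =>
      -- preliminary localisation of the argument: `|s - d| < 1`
      obtain ⟨d, hd⟩ := ih 0 one_pos
      -- a rational bound `U ≥ e^{d+3}` (any `m > d + 3` works; in `ℝ`, `uₘ ≥ exp`)
      set B : ℚ := d + 3 with hB
      obtain ⟨m₀, hm₀pos, hm₀⟩ : ∃ m₀ : ℕ, 0 < m₀ ∧ B < m₀ := by
        obtain ⟨n, hn⟩ := exists_nat_gt B
        exact ⟨n + 1, Nat.succ_pos n, hn.trans (by exact_mod_cast Nat.lt_succ_self n)⟩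
      set U : ℚ := upperEncl B m₀ with hU
      have hUexp : Real.exp B ≤ (U : ℝ) := le_upperEncl IsOrderedExp.real B hm₀pos hm₀
      have hUpos : 0 < U := by
        have : (0 : ℝ) < U := lt_of_lt_of_le (Real.exp_pos _) hUexp
        exact_mod_cast this
      -- the radius for the argument
      set δ : ℚ := min 1 (r / (4 * U)) with hδ
      have hδpos : 0 < δ := lt_min one_pos (by positivity)
      have hδ1 : δ ≤ 1 := min_le_left _ _
      have hδU : δ * U ≤ r / 4 := by
        have : δ ≤ r / (4 * U) := min_le_right _ _
        calc δ * U ≤ r / (4 * U) * U := by gcongr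
          _ = r / 4 := by field_simp
      obtain ⟨c, hc⟩ := ih 0 hδpos
      -- `c` is close to `d` (compare the two enclosures in `ℝ`)
      have hcd : |c - d| < 1 + δ := by
        let v₀ : α → ℝ := fun a => isEmptyElim a
        have h1 : |((ts 0).realize v₀ : ℝ) - (d : ℝ)| < ((1 : ℚ) : ℝ) := hd.real v₀
        have h2 : |((ts 0).realize v₀ : ℝ) - (c : ℝ)| < ((δ : ℚ) : ℝ) := hc.real v₀
        have h3 : |(c : ℝ) - d| < 1 + δ := by
          have key : |(c : ℝ) - d| ≤ |((ts 0).realize v₀ : ℝ) - (d : ℝ)| +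
              |((ts 0).realize v₀ : ℝ) - (c : ℝ)| := by
            have := abs_sub_comm ((ts 0).realize v₀ : ℝ) (c : ℝ)
            calc |(c : ℝ) - d| = |(((ts 0).realize v₀ : ℝ) - d) - (((ts 0).realize v₀ : ℝ) - c)| := by
                  ring_nf
              _ ≤ _ := abs_sub _ _
          push_cast at h1 h2
          linarith
        exact_mod_cast h3
      have hcδB : c + δ ≤ B := by
        rw [hB]; have := (abs_lt.1 hcd).2; linarith
      -- choose `m` making both enclosures of `e^{c ± δ}` tight in `ℝ`
      have hev₁ : ∀ᶠ m : ℕ in atTop, (upperEncl (c + δ) m : ℝ) < Real.exp (c + δ : ℚ) + r / 4 :=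
        (tendsto_upperEncl (c + δ)).eventually_lt_const (by
          have : (0 : ℝ) < r := by exact_mod_cast hr
          linarith)
      have hev₂ : ∀ᶠ m : ℕ in atTop, Real.exp (c - δ : ℚ) - r / 4 < (lowerEncl (c - δ) m : ℝ) :=
        (tendsto_lowerEncl (c - δ)).eventually_const_lt (by
          have : (0 : ℝ) < r := by exact_mod_cast hr
          linarith)
      have hev₃ : ∀ᶠ m : ℕ in atTop, (|c| + 1 : ℚ) < m := by
        obtain ⟨n, hn⟩ := exists_nat_gt (|c| + 1 : ℚ)
        refine eventually_atTop.2 ⟨n, fun m hm => hn.trans_le (by exact_mod_cast hm)⟩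
      have hev₄ : ∀ᶠ m : ℕ in atTop, 0 < m := eventually_gt_atTop 0
      obtain ⟨m, ⟨⟨hm₁, hm₂⟩, hm₃⟩, hm₄⟩ := (((hev₁.and hev₂).and hev₃).and hev₄).exists
      -- the enclosure of `E(s)`: `L < E s < U'` with `L = ℓₘ(c - δ)`, `U' = uₘ(c + δ)`
      set L : ℚ := lowerEncl (c - δ) m with hL
      set U' : ℚ := upperEncl (c + δ) m with hU'
      have hcm₁ : -(c - δ) ≤ m := by
        have := neg_le_abs c; linarith
      have hcm₂ : c + δ < m := by
        have := le_abs_self c; linarith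
      -- width estimate in `ℝ`: `U' - L < r`
      have hwidth : U' - L < r := by
        have hmono : Real.exp (c + δ : ℚ) - Real.exp (c - δ : ℚ) ≤ r / 2 := by
          -- `e^x - e^y ≤ e^x (x - y)` for `y ≤ x`, and `e^{c+δ} ≤ e^B ≤ U`
          have hxy : Real.exp (c - δ : ℚ) ≥ Real.exp (c + δ : ℚ) * (1 + ((c - δ : ℚ) - (c + δ : ℚ) : ℝ)) := by
            have := Real.add_one_le_exp (((c - δ : ℚ) : ℝ) - ((c + δ : ℚ) : ℝ))
            have hpos := Real.exp_pos ((c + δ : ℚ) : ℝ)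
            calc Real.exp (c + δ : ℚ) * (1 + ((c - δ : ℚ) - (c + δ : ℚ) : ℝ))
                ≤ Real.exp (c + δ : ℚ) * Real.exp (((c - δ : ℚ) : ℝ) - ((c + δ : ℚ) : ℝ)) := by
                  gcongr; linarith
              _ = Real.exp (c - δ : ℚ) := by rw [← Real.exp_add]; ring_nf
          have hle : Real.exp (c + δ : ℚ) ≤ U := by
            refine le_trans (Real.exp_le_exp.2 ?_) hUexp
            exact_mod_cast hcδB
          have hδUR : (δ : ℝ) * U ≤ r / 4 := by exact_mod_cast hδU
          have hδR : (0 : ℝ) ≤ δ := by exact_mod_cast hδpos.le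
          push_cast at hxy hle ⊢
          have h1 : Real.exp ((c : ℝ) + δ) * (1 + ((c : ℝ) - δ - ((c : ℝ) + δ))) =
              Real.exp ((c : ℝ) + δ) - 2 * ((δ : ℝ) * Real.exp ((c : ℝ) + δ)) := by ring
          rw [h1] at hxy
          have h2 : (δ : ℝ) * Real.exp ((c : ℝ) + δ) ≤ (δ : ℝ) * U :=
            mul_le_mul_of_nonneg_left hle hδR
          linarith
        have : (U' : ℝ) - L < r := by
          push_cast [hL, hU'] at hm₁ hm₂ hmono ⊢
          linarith
        exact_mod_cast this
      refine ⟨(L + U') / 2, fun K _ _ _ _ _ E' hE hexp v => ?_⟩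
      rw [Term.realize_func, hexp]
      have hs := hc K E' hE hexp v
      change |E' ((ts 0).realize v) - _| < _
      set s : K := (ts 0).realize v
      have hs' := abs_lt.1 hs
      -- `E(c - δ) < E(s) < E(c + δ)` in `K`
      have hlo : E' ((c - δ : ℚ) : K) < E' s := hE.strictMono (by push_cast; linarith)
      have hhi : E' s < E' ((c + δ : ℚ) : K) := hE.strictMono (by push_cast; linarith)
      have hLK : ((L : ℚ) : K) ≤ E' ((c - δ : ℚ) : K) := lowerEncl_le hE (c - δ) hm₄ hcm₁
      have hUK : E' ((c + δ : ℚ) : K) ≤ ((U' : ℚ) : K) := le_upperEncl hE (c + δ) hm₄ hcm₂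
      have hw : ((U' : ℚ) : K) - L < r := by
        have := Rat.cast_lt (K := K) |>.2 hwidth
        push_cast at this ⊢
        exact this
      rw [abs_lt]
      push_cast
      constructor <;> linarith
end Terms

/-! ### Transfer of strict inequalities -/

section Transfer

variable {α : Type} [IsEmpty α]

/-- **Strict inequalities between closed exponential terms transfer from `ℝ` to every ordered
exponential field with `E(x) ≥ 1 + x`** (the exponential analogue of Jones–Servi 2011,
Lemma 3.6, "`ℝ^α ⊨ h(q̄) < 0` ⇒ `T ⊢ h(q̄) < 0`", for the weakest `T`): if `s^ℝ < t^ℝ` for closed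
terms `s, t` of `Language.orderedExpRing`, then `s^K < t^K` in every ordered field `K` (in `Type`)
with a lawful structure whose `exp` symbol is interpreted by an `IsOrderedExp` map. [cite: JonesServi2011, Lemma 3.6] -/
theorem realize_lt_realize_of_real {s t : Language.orderedExpRing.Term α} (v₀ : α → ℝ)
    (h : s.realize v₀ < t.realize v₀)
    (K : Type) [Field K] [LinearOrder K] [IsStrictOrderedRing K]
    [Language.orderedExpRing.Structure K] [RealExpModel.LawfulStructure K] (E : K → K)
    (hE : IsOrderedExp E)
    (hexp : ∀ w : Fin 1 → K, Structure.funMap (L := Language.orderedExpRing) expRingFunc.exp w = E (w 0))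
    (v : α → K) : s.realize v < t.realize v := by
  -- a rational radius below a quarter of the gap
  obtain ⟨r, hr₀, hr⟩ := exists_rat_btwn (show (0 : ℝ) < (t.realize v₀ - s.realize v₀) / 4 by linarith)
  have hrpos : 0 < r := by exact_mod_cast hr₀
  obtain ⟨cs, hcs⟩ := exists_uniformlyNear s hrpos
  obtain ⟨ct, hct⟩ := exists_uniformlyNear t hrpos
  -- in `ℝ` the centres are separated by at least `2r`
  have hv₀ : v₀ = fun a => isEmptyElim a := funext fun a => isEmptyElim a
  have h₁ := abs_lt.1 (hcs.real v₀)
  have h₂ := abs_lt.1 (hct.real v₀)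
  have hsep : cs + r ≤ ct - r := by
    have : (cs : ℝ) + r ≤ ct - r := by linarith
    exact_mod_cast this
  -- in `K`
  have hsK := abs_lt.1 (hcs K E hE hexp v)
  have htK := abs_lt.1 (hct K E hE hexp v)
  have hsepK : (cs : K) + r ≤ (ct : K) - r := by
    have := Rat.cast_le (K := K) |>.2 hsep
    push_cast at this
    exact this
  linarith

/-- The same for the atomic formula `s < t` (`ExpFormula.lt`, realized in lawful structures by
`ExpFormula.realize_lt`): if `ℝ ⊨ s < t` then `K ⊨ s < t`. [cite: JonesServi2011, Lemma 3.6] -/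
theorem realize_expFormulaLt_of_real {s t : Language.orderedExpRing.Term α} (v₀ : α → ℝ)
    (h : (ExpFormula.lt s t).Realize v₀)
    (K : Type) [Field K] [LinearOrder K] [IsStrictOrderedRing K]
    [Language.orderedExpRing.Structure K] [RealExpModel.LawfulStructure K] (E : K → K)
    (hE : IsOrderedExp E)
    (hexp : ∀ w : Fin 1 → K, Structure.funMap (L := Language.orderedExpRing) expRingFunc.exp w = E (w 0))
    (v : α → K) : (ExpFormula.lt s t).Realize v := by
  rw [ExpFormula.realize_lt] at h ⊢
  exact realize_lt_realize_of_real v₀ h K E hE hexp v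

end Transfer

end Literature.ModelTheory.ExponentialFields

end
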